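import Mathlib.Analysis.Distribution.SchwartzSpace.Basic
import Mathlib.Analysis.Distribution.TemperateGrowth
import HarnessLib

/-!
# UNIFORMLY temperate families of multipliers: uniform Schwartz seminorm bounds and uniform rapid decay

Topic `Analysis/Distribution`; namespace `Literature.Analysis.Distribution`.  PROOF file (theorems only; no definition, no
instance, no notation, no named fact, no `sorry`).  Cell `hodgecm-mathlib` FLOOR 0, crux H413, E-2 ∕ SW2 identity road, row (G3)
«dominated families», archimedean engine of letter (G3-C) (B-p12 (g19) census `CENSUS-G3-DominatedFamilies.v0` §(G3-C); F0P4-plan (g3);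
B-p09 (g18)).  HC_CM is proved only modulo the printed citations until rung 0 closes — nothing here bears on a summit statement.

Mathlib's `SchwartzMap.bilinLeftCLM B hg` ∕ `smulLeftCLM` multiply a Schwartz function by ONE function `g` of temperate growth; the
constants of the seminorm estimate are hidden inside the continuous linear map.  The (G3) letters need the estimate UNIFORMLY over a
FAMILY `g_c`, `c ∈ S` (chirps `a ↦ 𝐞(β q(a))` for `β` in a compact set, dilations by a compact set of matrices).  This file replays
the Mathlib estimates with the constants exposed, under the def-free hypothesis «`(g_c)_{c ∈ S}` is UNIFORMLY TEMPERATE»: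
`∀ N, ∃ l C, ∀ c ∈ S, ∀ n ≤ N, ∀ x, ‖D^n (g c) x‖ ≤ C (1 + ‖x‖)^l` (plus smoothness of each `g c`).

* §1 **`exists_bound_bilin_uniform`** — for a continuous bilinear `B` and a uniformly temperate family: for every `(k, n)` there are a
  finite set `s` of Schwartz seminorms and `C'` with `‖x‖^k ‖D^n (B (f ·) (g_c ·)) x‖ ≤ C' · (s.sup p)(f)` for ALL `c ∈ S`, all `f`, all `x`
  (Mathlib's `bilinLeftCLM` proof, verbatim with `c`); **`exists_seminorm_bilinLeftCLM_le_uniform`**, **`exists_seminorm_smulLeftCLM_le_uniform`**.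
* §2 **`uniform_slice_of_hasTemperateGrowth`** — the slices `a ↦ ψ (c, a)` of ONE function of temperate growth on `W × V`, for `c` in a
  BOUNDED set, form a uniformly temperate family (restriction along `a ↦ (c, a)`).
* §3 **`uniform_comp_of_bounded_derivs`** — post-composition with a smooth `h : F → G` ALL of whose derivatives are bounded (e.g. the
  character `s ↦ 𝐞(s)`, `|𝐞^{(n)}| ≤ (2π)^n`) preserves uniform temperateness (Faà di Bruno with constants, Mathlib
  `norm_iteratedFDeriv_comp_le`).
* §4 **`exists_forall_seminorm_le_of_uniform`** ∕ **`exists_forall_norm_mul_pow_le_of_uniform`** — a continuous linear map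
  `T : 𝓢(D, E) →L 𝓢(V, G)` carries a family with uniformly bounded seminorms to one with uniformly bounded seminorms
  (`Seminorm.bound_of_continuous` for `schwartz_withSeminorms`), hence to a family of UNIFORM RAPID DECAY
  `‖T (f_c) ξ‖ (1 + ‖ξ‖)^N ≤ C_N` — the input of ★ `SchwartzEnvelope.exists_schwartz_complex_forall_norm_le_of_uniform_rapid_decay`
  (B-p12 (g19)), which turns it into ONE Schwartz dominant.

## References
* L. Hörmander, *The Analysis of Linear Partial Differential Operators I*, 2nd ed. (1990), §7.1 (the topology of `𝒮`; continuity of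
  multiplication by `𝒪_M` and of `𝓕`). [HormanderALPDO1]
* A. Weil, *Sur certains groupes d'opérateurs unitaires*, Acta Math. 111 (1964), Chap. III n° 41, Lemme 5 (one dominant for a compact
  family of operators). [folklore]
-/

noncomputable section

open scoped SchwartzMap ContDiff
open Function

namespace Literature.Analysis.Distribution

variable {𝕜 : Type*} [NontriviallyNormedField 𝕜] [NormedAlgebra ℝ 𝕜]
  {D : Type*} [NormedAddCommGroup D] [NormedSpace ℝ D]
  {E : Type*} [NormedAddCommGroup E] [NormedSpace ℝ E] [NormedSpace 𝕜 E]
  {F : Type*} [NormedAddCommGroup F] [NormedSpace ℝ F] [NormedSpace 𝕜 F]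
  {G : Type*} [NormedAddCommGroup G] [NormedSpace ℝ G] [NormedSpace 𝕜 G]
  [SMulCommClass ℝ 𝕜 E] [SMulCommClass ℝ 𝕜 G]

/-! ## §1 Uniform `bilinLeftCLM` ∕ `smulLeftCLM` bounds -/

section Bilin

variable {ι' : Type*} {S : Set ι'} {g : ι' → D → F}

/-- A uniformly temperate family (smooth members, uniform polynomial bounds on all derivatives) consists of functions of temperate
growth. [cite: HormanderALPDO1, §7.1] -/
theorem hasTemperateGrowth_of_uniform (hsmooth : ∀ c ∈ S, ContDiff ℝ ∞ (g c))
    (hg : ∀ N : ℕ, ∃ (l : ℕ) (C : ℝ), 0 ≤ C ∧ ∀ c ∈ S, ∀ n ≤ N, ∀ x, ‖iteratedFDeriv ℝ n (g c) x‖ ≤ C * (1 + ‖x‖) ^ l)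
    {c : ι'} (hc : c ∈ S) : (g c).HasTemperateGrowth := by
  refine ⟨hsmooth c hc, fun n => ?_⟩
  obtain ⟨l, C, -, h⟩ := hg n
  exact ⟨l, C, fun x => h c hc n le_rfl x⟩

omit [SMulCommClass ℝ 𝕜 G] in
/-- **Uniform pointwise Schwartz estimate for `x ↦ B (f x) (g_c x)`** over a UNIFORMLY temperate family `(g_c)_{c ∈ S}`: for every
`(k, n)` there are finitely many Schwartz seminorms and one constant with
`‖x‖^k ‖D^n (B (f ·) (g_c ·)) x‖ ≤ C' · sup_{(k',n') ∈ s} p_{k',n'}(f)` for all `c ∈ S`, `f`, `x` (the estimate inside Mathlib's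
`SchwartzMap.bilinLeftCLM`, with the dependence on `g` made explicit). [cite: HormanderALPDO1, §7.1] -/
theorem exists_bound_bilin_uniform (B : E →L[𝕜] F →L[𝕜] G) (hsmooth : ∀ c ∈ S, ContDiff ℝ ∞ (g c))
    (hg : ∀ N : ℕ, ∃ (l : ℕ) (C : ℝ), 0 ≤ C ∧ ∀ c ∈ S, ∀ n ≤ N, ∀ x, ‖iteratedFDeriv ℝ n (g c) x‖ ≤ C * (1 + ‖x‖) ^ l)
    (k n : ℕ) :
    ∃ (s : Finset (ℕ × ℕ)) (C' : ℝ), 0 ≤ C' ∧ ∀ c ∈ S, ∀ (f : 𝓢(D, E)) (x : D),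
      ‖x‖ ^ k * ‖iteratedFDeriv ℝ n (fun y => B (f y) (g c y)) x‖ ≤ C' * (s.sup (schwartzSeminormFamily 𝕜 D E)) f := by
  obtain ⟨l, C, hC, hgrowth⟩ := hg n
  refine ⟨Finset.Iic (l + k, n), ‖B‖ * ((n : ℝ) + 1) * n.choose (n / 2) * (C * 2 ^ (l + k)), by positivity,
    fun c hc f x => ?_⟩
  have hxk : 0 ≤ ‖x‖ ^ k := by positivity
  have hgc : ContDiff ℝ ∞ (g c) := hsmooth c hc
  have hnorm_mul := ContinuousLinearMap.norm_iteratedFDeriv_le_of_bilinear (B.bilinearRestrictScalars ℝ)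
    (f.smooth ⊤) hgc x (n := n) (mod_cast le_top)
  simp_rw [ContinuousLinearMap.bilinearRestrictScalars_apply_apply] at hnorm_mul
  rw [ContinuousLinearMap.norm_bilinearRestrictScalars] at hnorm_mul
  -- each summand: `choose n i * ‖D^i f x‖ * ‖D^{n-i} g_c x‖ ≤ choose n (n/2) * ‖D^i f x‖ * C (1+‖x‖)^l`
  have hsum : ‖x‖ ^ k * ∑ i ∈ Finset.range (n + 1),
      (n.choose i : ℝ) * ‖iteratedFDeriv ℝ i f x‖ * ‖iteratedFDeriv ℝ (n - i) (g c) x‖ ≤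
      ((n : ℝ) + 1) * n.choose (n / 2) * (C * 2 ^ (l + k)) *
        (Finset.Iic (l + k, n)).sup (schwartzSeminormFamily 𝕜 D E) f := by
    rw [Finset.mul_sum]
    have hterm : ∀ i ∈ Finset.range (n + 1),
        ‖x‖ ^ k * ((n.choose i : ℝ) * ‖iteratedFDeriv ℝ i f x‖ * ‖iteratedFDeriv ℝ (n - i) (g c) x‖) ≤
          n.choose (n / 2) * (C * 2 ^ (l + k)) * (Finset.Iic (l + k, n)).sup (schwartzSeminormFamily 𝕜 D E) f := by
      intro i hi
      rw [Finset.mem_range_succ_iff] at hi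
      have h1 : (n.choose i : ℝ) ≤ n.choose (n / 2) := by exact_mod_cast i.choose_le_middle n
      have h2 : ‖iteratedFDeriv ℝ (n - i) (g c) x‖ ≤ C * (1 + ‖x‖) ^ l := hgrowth c hc (n - i) (Nat.sub_le n i) x
      have h3 : (1 + ‖x‖) ^ (l + k) * ‖iteratedFDeriv ℝ i f x‖ ≤
          2 ^ (l + k) * (Finset.Iic (l + k, n)).sup (schwartzSeminormFamily 𝕜 D E) f :=
        SchwartzMap.one_add_le_sup_seminorm_apply (m := (l + k, n)) le_rfl hi f x
      have h4 : ‖x‖ ^ k * (1 + ‖x‖) ^ l ≤ (1 + ‖x‖) ^ (l + k) := by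
        rw [pow_add, mul_comm]
        exact mul_le_mul_of_nonneg_left
          (pow_le_pow_left₀ (norm_nonneg _) (by linarith [norm_nonneg x]) k) (by positivity)
      calc ‖x‖ ^ k * ((n.choose i : ℝ) * ‖iteratedFDeriv ℝ i f x‖ * ‖iteratedFDeriv ℝ (n - i) (g c) x‖)
          ≤ ‖x‖ ^ k * ((n.choose (n / 2) : ℝ) * ‖iteratedFDeriv ℝ i f x‖ * (C * (1 + ‖x‖) ^ l)) := by
            gcongr
        _ = (n.choose (n / 2) : ℝ) * C * ((‖x‖ ^ k * (1 + ‖x‖) ^ l) * ‖iteratedFDeriv ℝ i f x‖) := by ring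
        _ ≤ (n.choose (n / 2) : ℝ) * C * ((1 + ‖x‖) ^ (l + k) * ‖iteratedFDeriv ℝ i f x‖) := by
            gcongr
        _ ≤ (n.choose (n / 2) : ℝ) * C * (2 ^ (l + k) * (Finset.Iic (l + k, n)).sup (schwartzSeminormFamily 𝕜 D E) f) := by
            gcongr
        _ = n.choose (n / 2) * (C * 2 ^ (l + k)) * (Finset.Iic (l + k, n)).sup (schwartzSeminormFamily 𝕜 D E) f := by
            ring
    calc ∑ i ∈ Finset.range (n + 1),
          ‖x‖ ^ k * ((n.choose i : ℝ) * ‖iteratedFDeriv ℝ i f x‖ * ‖iteratedFDeriv ℝ (n - i) (g c) x‖)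
        ≤ ∑ _i ∈ Finset.range (n + 1),
          (n.choose (n / 2) : ℝ) * (C * 2 ^ (l + k)) * (Finset.Iic (l + k, n)).sup (schwartzSeminormFamily 𝕜 D E) f :=
          Finset.sum_le_sum hterm
      _ = ((n : ℝ) + 1) * n.choose (n / 2) * (C * 2 ^ (l + k)) *
            (Finset.Iic (l + k, n)).sup (schwartzSeminormFamily 𝕜 D E) f := by
          rw [Finset.sum_const, Finset.card_range, nsmul_eq_mul]
          push_cast
          ring
  calc ‖x‖ ^ k * ‖iteratedFDeriv ℝ n (fun y => B (f y) (g c y)) x‖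
      ≤ ‖x‖ ^ k * (‖B‖ * ∑ i ∈ Finset.range (n + 1),
          (n.choose i : ℝ) * ‖iteratedFDeriv ℝ i f x‖ * ‖iteratedFDeriv ℝ (n - i) (g c) x‖) :=
        mul_le_mul_of_nonneg_left hnorm_mul hxk
    _ = ‖B‖ * (‖x‖ ^ k * ∑ i ∈ Finset.range (n + 1),
          (n.choose i : ℝ) * ‖iteratedFDeriv ℝ i f x‖ * ‖iteratedFDeriv ℝ (n - i) (g c) x‖) := by ring
    _ ≤ ‖B‖ * (((n : ℝ) + 1) * n.choose (n / 2) * (C * 2 ^ (l + k)) *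
          (Finset.Iic (l + k, n)).sup (schwartzSeminormFamily 𝕜 D E) f) :=
        mul_le_mul_of_nonneg_left hsum (by positivity)
    _ = ‖B‖ * ((n : ℝ) + 1) * n.choose (n / 2) * (C * 2 ^ (l + k)) *
          (Finset.Iic (l + k, n)).sup (schwartzSeminormFamily 𝕜 D E) f := by ring

/-- **Uniform seminorm bound for `bilinLeftCLM` over a uniformly temperate family**:
`p_{k,n}(bilinLeftCLM B (g_c) f) ≤ C' · (s.sup p)(f)` with `s`, `C'` independent of `c ∈ S`. [cite: HormanderALPDO1, §7.1] -/
theorem exists_seminorm_bilinLeftCLM_le_uniform (B : E →L[𝕜] F →L[𝕜] G) (hsmooth : ∀ c ∈ S, ContDiff ℝ ∞ (g c))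
    (hg : ∀ N : ℕ, ∃ (l : ℕ) (C : ℝ), 0 ≤ C ∧ ∀ c ∈ S, ∀ n ≤ N, ∀ x, ‖iteratedFDeriv ℝ n (g c) x‖ ≤ C * (1 + ‖x‖) ^ l)
    (k n : ℕ) :
    ∃ (s : Finset (ℕ × ℕ)) (C' : ℝ), 0 ≤ C' ∧ ∀ (c : ι') (hc : c ∈ S) (f : 𝓢(D, E)),
      SchwartzMap.seminorm 𝕜 k n (SchwartzMap.bilinLeftCLM B (hasTemperateGrowth_of_uniform hsmooth hg hc) f) ≤
        C' * (s.sup (schwartzSeminormFamily 𝕜 D E)) f := by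
  obtain ⟨s, C', hC', hb⟩ := exists_bound_bilin_uniform (𝕜 := 𝕜) B hsmooth hg k n
  refine ⟨s, C', hC', fun c hc f => SchwartzMap.seminorm_le_bound 𝕜 k n _ (by positivity) fun x => ?_⟩
  rw [SchwartzMap.bilinLeftCLM_apply]
  exact hb c hc f x

end Bilin

section Smul

variable {ι' : Type*} {S : Set ι'} {g : ι' → D → 𝕜}

/-- **Uniform seminorm bound for `smulLeftCLM` over a uniformly temperate family of scalar multipliers**:
`p_{k,n}(g_c • f) ≤ C' · (s.sup p)(f)` with `s`, `C'` independent of `c ∈ S`. [cite: HormanderALPDO1, §7.1] -/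
theorem exists_seminorm_smulLeftCLM_le_uniform (hsmooth : ∀ c ∈ S, ContDiff ℝ ∞ (g c))
    (hg : ∀ N : ℕ, ∃ (l : ℕ) (C : ℝ), 0 ≤ C ∧ ∀ c ∈ S, ∀ n ≤ N, ∀ x, ‖iteratedFDeriv ℝ n (g c) x‖ ≤ C * (1 + ‖x‖) ^ l)
    (k n : ℕ) :
    ∃ (s : Finset (ℕ × ℕ)) (C' : ℝ), 0 ≤ C' ∧ ∀ c ∈ S, ∀ f : 𝓢(D, E),
      SchwartzMap.seminorm 𝕜 k n (SchwartzMap.smulLeftCLM E (g c) f) ≤ C' * (s.sup (schwartzSeminormFamily 𝕜 D E)) f := by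
  obtain ⟨s, C', hC', hb⟩ :=
    exists_bound_bilin_uniform (𝕜 := 𝕜) (ContinuousLinearMap.lsmul 𝕜 𝕜 : 𝕜 →L[𝕜] E →L[𝕜] E).flip hsmooth hg k n
  refine ⟨s, C', hC', fun c hc f => SchwartzMap.seminorm_le_bound 𝕜 k n _ (by positivity) fun x => ?_⟩
  rw [SchwartzMap.smulLeftCLM_apply (hasTemperateGrowth_of_uniform hsmooth hg hc)]
  exact hb c hc f x

end Smul

/-! ## §2 Slices of one temperate function over a bounded parameter set -/

section Slice

variable {W : Type*} [NormedAddCommGroup W] [NormedSpace ℝ W] {V : Type*} [NormedAddCommGroup V] [NormedSpace ℝ V]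
  {F' : Type*} [NormedAddCommGroup F'] [NormedSpace ℝ F']

/-- `‖inr‖ ≤ 1` for the inclusion `V → W × V` (sup norm on the product). [folklore] -/
private theorem norm_inr_le_one : ‖ContinuousLinearMap.inr ℝ W V‖ ≤ 1 :=
  ContinuousLinearMap.opNorm_le_bound _ zero_le_one fun x => by
    rw [one_mul, ContinuousLinearMap.inr_apply, Prod.norm_mk, norm_zero, max_eq_right (norm_nonneg _)]

/-- **Slices of ONE function of temperate growth over a BOUNDED parameter set form a uniformly temperate family**: for
`ψ : W × V → F'` of temperate growth and `‖c‖ ≤ R` on `S`, the functions `a ↦ ψ (c, a)`, `c ∈ S`, are smooth with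
`‖D^n (ψ(c, ·)) a‖ ≤ C (1+R)^l (1 + ‖a‖)^l` uniformly (restriction along the isometric inclusion `a ↦ (c, a)`).
[cite: HormanderALPDO1, §7.1] -/
theorem uniform_slice_of_hasTemperateGrowth {ψ : W × V → F'} (hψ : ψ.HasTemperateGrowth) {S : Set W} {R : ℝ}
    (hR : 0 ≤ R) (hS : ∀ c ∈ S, ‖c‖ ≤ R) :
    (∀ c ∈ S, ContDiff ℝ ∞ (fun a : V => ψ (c, a))) ∧
      ∀ N : ℕ, ∃ (l : ℕ) (C : ℝ), 0 ≤ C ∧ ∀ c ∈ S, ∀ n ≤ N, ∀ a : V,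
        ‖iteratedFDeriv ℝ n (fun a : V => ψ (c, a)) a‖ ≤ C * (1 + ‖a‖) ^ l := by
  have hslice : ∀ c : W, (fun a : V => ψ (c, a)) =
      (fun y : W × V => ψ (y + (c, 0))) ∘ ⇑(ContinuousLinearMap.inr ℝ W V) := by
    intro c
    funext a
    simp only [Function.comp_apply, ContinuousLinearMap.inr_apply, Prod.mk_add_mk, zero_add, add_zero]
  refine ⟨fun c _ => hψ.1.comp (contDiff_const.prodMk contDiff_id), fun N => ?_⟩
  obtain ⟨l, C, hC, hb⟩ := hψ.norm_iteratedFDeriv_le_uniform N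
  refine ⟨l, C * (1 + R) ^ l, by positivity, fun c hc n hn a => ?_⟩
  have htrans : ContDiff ℝ ∞ (fun y : W × V => ψ (y + (c, 0))) := hψ.1.comp (contDiff_id.add contDiff_const)
  rw [hslice c, ContinuousLinearMap.iteratedFDeriv_comp_right _ htrans a (mod_cast le_top)]
  have h1 : ‖iteratedFDeriv ℝ n (fun y : W × V => ψ (y + (c, 0))) (ContinuousLinearMap.inr ℝ W V a)‖ ≤
      C * (1 + ‖(c, a)‖) ^ l := by
    rw [iteratedFDeriv_comp_add_right, ContinuousLinearMap.inr_apply, Prod.mk_add_mk, zero_add, add_zero]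
    exact hb n hn (c, a)
  have h2 : (1 + ‖(c, a)‖) ^ l ≤ ((1 + R) * (1 + ‖a‖)) ^ l := by
    refine pow_le_pow_left₀ (by positivity) ?_ l
    rw [Prod.norm_mk]
    have := hS c hc
    rcases le_total ‖c‖ ‖a‖ with h | h
    · rw [max_eq_right h]; nlinarith [norm_nonneg a]
    · rw [max_eq_left h]; nlinarith [norm_nonneg a]
  calc ‖(iteratedFDeriv ℝ n (fun y : W × V => ψ (y + (c, 0))) (ContinuousLinearMap.inr ℝ W V a)).compContinuousLinearMap
        fun _ => ContinuousLinearMap.inr ℝ W V‖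
      ≤ ‖iteratedFDeriv ℝ n (fun y : W × V => ψ (y + (c, 0))) (ContinuousLinearMap.inr ℝ W V a)‖ *
          ∏ _i : Fin n, ‖ContinuousLinearMap.inr ℝ W V‖ :=
        ContinuousMultilinearMap.norm_compContinuousLinearMap_le _ _
    _ ≤ C * (1 + ‖(c, a)‖) ^ l * 1 := by
        refine mul_le_mul h1 ?_ (by positivity) (by positivity)
        exact Finset.prod_le_one (fun _ _ => norm_nonneg _) fun _ _ => norm_inr_le_one
    _ ≤ C * ((1 + R) * (1 + ‖a‖)) ^ l * 1 := by gcongr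
    _ = C * (1 + R) ^ l * (1 + ‖a‖) ^ l := by rw [mul_pow]; ring

end Slice

/-! ## §3 Post-composition with a function all of whose derivatives are bounded -/

section Comp

variable {V : Type*} [NormedAddCommGroup V] [NormedSpace ℝ V] {F' : Type*} [NormedAddCommGroup F'] [NormedSpace ℝ F']
  {G' : Type*} [NormedAddCommGroup G'] [NormedSpace ℝ G'] {ι' : Type*} {S : Set ι'}

/-- **Post-composition with a smooth function with bounded derivatives preserves uniform temperateness** (Faà di Bruno with
constants, Mathlib `norm_iteratedFDeriv_comp_le`): if `‖D^i h‖ ≤ M_N` for `i ≤ N` and `(ψ_c)_{c ∈ S}` is uniformly temperate, then so is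
`(h ∘ ψ_c)_{c ∈ S}`, with `‖D^n (h ∘ ψ_c) a‖ ≤ N! M_N (1 + C)^N (1 + ‖a‖)^{lN}` for `n ≤ N`.  (Example: `h = 𝐞`, `|𝐞^{(i)}| ≤ (2π)^i`.)
[cite: HormanderALPDO1, §7.1] -/
theorem uniform_comp_of_bounded_derivs {h : F' → G'} (hh1 : ContDiff ℝ ∞ h)
    (hh : ∀ N : ℕ, ∃ M : ℝ, 0 ≤ M ∧ ∀ i ≤ N, ∀ y, ‖iteratedFDeriv ℝ i h y‖ ≤ M)
    {ψ : ι' → V → F'} (hsmooth : ∀ c ∈ S, ContDiff ℝ ∞ (ψ c))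
    (hψ : ∀ N : ℕ, ∃ (l : ℕ) (C : ℝ), 0 ≤ C ∧ ∀ c ∈ S, ∀ n ≤ N, ∀ a, ‖iteratedFDeriv ℝ n (ψ c) a‖ ≤ C * (1 + ‖a‖) ^ l) :
    (∀ c ∈ S, ContDiff ℝ ∞ (h ∘ ψ c)) ∧
      ∀ N : ℕ, ∃ (l : ℕ) (C : ℝ), 0 ≤ C ∧ ∀ c ∈ S, ∀ n ≤ N, ∀ a,
        ‖iteratedFDeriv ℝ n (h ∘ ψ c) a‖ ≤ C * (1 + ‖a‖) ^ l := by
  refine ⟨fun c hc => hh1.comp (hsmooth c hc), fun N => ?_⟩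
  obtain ⟨l, C, hC, hb⟩ := hψ N
  obtain ⟨M, hM, hMb⟩ := hh N
  refine ⟨l * N, (N.factorial : ℝ) * M * (1 + C) ^ N, by positivity, fun c hc n hn a => ?_⟩
  have hD : ∀ i, 1 ≤ i → i ≤ n → ‖iteratedFDeriv ℝ i (ψ c) a‖ ≤ ((1 + C) * (1 + ‖a‖) ^ l) ^ i := by
    intro i hi hin
    calc ‖iteratedFDeriv ℝ i (ψ c) a‖ ≤ C * (1 + ‖a‖) ^ l := hb c hc i (hin.trans hn) a
      _ ≤ (1 + C) * (1 + ‖a‖) ^ l := by gcongr; linarith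
      _ ≤ ((1 + C) * (1 + ‖a‖) ^ l) ^ i :=
          le_self_pow₀ (one_le_mul_of_one_le_of_one_le (by linarith)
            (one_le_pow₀ (by linarith [norm_nonneg a]))) (by omega)
  have hCb : ∀ i, i ≤ n → ‖iteratedFDeriv ℝ i h (ψ c a)‖ ≤ M := fun i hi => hMb i (hi.trans hn) _
  have hmain := norm_iteratedFDeriv_comp_le hh1 (hsmooth c hc) (n := n) (mod_cast le_top) a hCb hD
  have h1a : (1 : ℝ) ≤ 1 + ‖a‖ := by linarith [norm_nonneg a]
  calc ‖iteratedFDeriv ℝ n (h ∘ ψ c) a‖ ≤ (n.factorial : ℝ) * M * ((1 + C) * (1 + ‖a‖) ^ l) ^ n := hmain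
    _ = (n.factorial : ℝ) * M * (1 + C) ^ n * (1 + ‖a‖) ^ (l * n) := by rw [mul_pow, ← pow_mul]; ring
    _ ≤ (N.factorial : ℝ) * M * (1 + C) ^ N * (1 + ‖a‖) ^ (l * N) := by
        have hf : (n.factorial : ℝ) ≤ N.factorial := by exact_mod_cast Nat.factorial_le hn
        have hc : (1 + C) ^ n ≤ (1 + C) ^ N := pow_le_pow_right₀ (by linarith) hn
        have ha : (1 + ‖a‖) ^ (l * n) ≤ (1 + ‖a‖) ^ (l * N) := pow_le_pow_right₀ h1a (Nat.mul_le_mul_left l hn)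
        have hM1 : 0 ≤ (N.factorial : ℝ) * M := by positivity
        calc (n.factorial : ℝ) * M * (1 + C) ^ n * (1 + ‖a‖) ^ (l * n)
            ≤ (N.factorial : ℝ) * M * (1 + C) ^ n * (1 + ‖a‖) ^ (l * n) := by gcongr
          _ ≤ (N.factorial : ℝ) * M * (1 + C) ^ N * (1 + ‖a‖) ^ (l * N) := by
              apply mul_le_mul (mul_le_mul_of_nonneg_left hc hM1) ha (by positivity) (by positivity)

end Comp

/-! ## §4 Transport through a continuous linear map; uniform rapid decay -/

section Transport

variable {V : Type*} [NormedAddCommGroup V] [NormedSpace ℝ V] {ι' : Type*} {S : Set ι'}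

omit [NormedAlgebra ℝ 𝕜] in
/-- **A continuous linear map of Schwartz spaces carries a family with uniformly bounded seminorms to a family with uniformly
bounded seminorms** (`Seminorm.bound_of_continuous` for Mathlib's `schwartz_withSeminorms`). [cite: HormanderALPDO1, §7.1] -/
theorem exists_forall_seminorm_le_of_uniform (T : 𝓢(D, E) →L[𝕜] 𝓢(V, G)) {f : ι' → 𝓢(D, E)}
    (hf : ∀ m : ℕ × ℕ, ∃ M : ℝ, ∀ c ∈ S, SchwartzMap.seminorm 𝕜 m.1 m.2 (f c) ≤ M) (m : ℕ × ℕ) :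
    ∃ M' : ℝ, ∀ c ∈ S, SchwartzMap.seminorm 𝕜 m.1 m.2 (T (f c)) ≤ M' := by
  classical
  set q : Seminorm 𝕜 𝓢(D, E) := (schwartzSeminormFamily 𝕜 V G m).comp T.toLinearMap with hq_def
  have hq : Continuous q := ((schwartz_withSeminorms 𝕜 V G).continuous_seminorm m).comp T.continuous
  obtain ⟨s, C, -, hle⟩ := Seminorm.bound_of_continuous (schwartz_withSeminorms 𝕜 D E) q hq
  choose M hM using hf
  refine ⟨C * ∑ i ∈ s, |M i|, fun c hc => ?_⟩
  have h1 : q (f c) ≤ (C • s.sup (schwartzSeminormFamily 𝕜 D E)) (f c) := hle (f c)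
  rw [_root_.smul_apply] at h1
  change q (f c) ≤ (C : ℝ) * _ at h1
  have h2 : (s.sup (schwartzSeminormFamily 𝕜 D E)) (f c) ≤ ∑ i ∈ s, |M i| :=
    Seminorm.finset_sup_apply_le (Finset.sum_nonneg fun i _ => abs_nonneg (M i)) fun i hi =>
      ((hM i c hc).trans (le_abs_self (M i))).trans
        (Finset.single_le_sum (fun j _ => abs_nonneg (M j)) hi)
  calc SchwartzMap.seminorm 𝕜 m.1 m.2 (T (f c)) = q (f c) := rfl
    _ ≤ (C : ℝ) * (s.sup (schwartzSeminormFamily 𝕜 D E)) (f c) := h1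
    _ ≤ C * ∑ i ∈ s, |M i| := mul_le_mul_of_nonneg_left h2 C.2

omit [NormedAlgebra ℝ 𝕜] in
/-- **Uniform rapid decay of the images**: under the same hypothesis, for every `N` one constant bounds
`(1 + ‖ξ‖)^N ‖T (f_c) ξ‖` for all `c ∈ S` and all `ξ` — the input of a Schwartz-envelope construction (one Schwartz function
dominating the whole family `T (f_c)`). [cite: HormanderALPDO1, §7.1] -/
theorem exists_forall_norm_mul_pow_le_of_uniform (T : 𝓢(D, E) →L[𝕜] 𝓢(V, G)) {f : ι' → 𝓢(D, E)}
    (hf : ∀ m : ℕ × ℕ, ∃ M : ℝ, ∀ c ∈ S, SchwartzMap.seminorm 𝕜 m.1 m.2 (f c) ≤ M) (N : ℕ) :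
    ∃ C : ℝ, ∀ c ∈ S, ∀ ξ : V, (1 + ‖ξ‖) ^ N * ‖T (f c) ξ‖ ≤ C := by
  classical
  choose M' hM' using fun m : ℕ × ℕ => exists_forall_seminorm_le_of_uniform (𝕜 := 𝕜) T hf m
  refine ⟨2 ^ N * ∑ m ∈ Finset.Iic (N, 0), |M' m|, fun c hc ξ => ?_⟩
  have h := SchwartzMap.one_add_le_sup_seminorm_apply (𝕜 := 𝕜) (m := (N, 0)) (k := N) (n := 0) le_rfl le_rfl (T (f c)) ξ
  rw [norm_iteratedFDeriv_zero] at h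
  refine h.trans (mul_le_mul_of_nonneg_left ?_ (by positivity))
  exact Seminorm.finset_sup_apply_le (Finset.sum_nonneg fun i _ => abs_nonneg (M' i)) fun i hi =>
    ((hM' i c hc).trans (le_abs_self (M' i))).trans (Finset.single_le_sum (fun j _ => abs_nonneg (M' j)) hi)

end Transport

end Literature.Analysis.Distribution

end
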